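import Summits.HubbardSuperconductivity.HubbardSuperconductivity.Theorems.AnisotropyChordTransferFibre3ChainLimit
import Summits.HubbardSuperconductivity.HubbardSuperconductivity.Theorems.AnisotropyChordTransferFibre3TwoHoleBSCovariance
import Summits.HubbardSuperconductivity.HubbardSuperconductivity.Theorems.AnisotropyChordTransferFibre3Lam2LogBound

/-!
# Route `AnisotropyChord` / H0 rotor rung: the ℤ² KERNEL `a_∞` — symmetries, the exact normalisation `a_∞(±1,0) = 1/4`, HARMONICITY, and the window in terms of `a_∞(1,1)`

Seventh file of the periodisation toolkit (memo ROTOR-THEORY-21 §320–§322; PartN37 `aInfKT` / `TorusKernelQuadraticLaw`).  The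
modulus-independent limit kernel `aZ2` of `…Fibre3ChainLimit` (with `|a^{(L)}_0 − aZ2| ≤ 2C₀|r|²/L` for every `L`) is shown to be the
genuine ℤ² potential-kernel difference, as far as elementary (integral-free) arguments reach:
* `tendsto_aKer_aZ2` (`a^{(2^{k+1})}_0(x,y) → aZ2 x y`), `tendsto_inv_sq_dyadic`, `Gres_mirror`;
* ★ symmetries `aZ2_swap`, `aZ2_neg`, `aZ2_mirror`, `aZ2_mirror_y`; `aZ2_zero` (`a_∞(0,0) = 0`);
* ★ NORMALISATION `aZ2_one_zero` / `aZ2_zero_one`: `a_∞(1,0) = a_∞(0,1) = 1/4` EXACTLY (torus axis value `(1 − 1/V)/4`, `aKer_zero_axis`);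
* ★★ HARMONICITY `aZ2_harmonic`: `Σ_e a_∞(r + e) = 4a_∞(r) + δ_{r,0}` (torus harmonicity `kernelHarmonicity_holds` at `λ = 0`; the
  zero-mode term `−1/V` disappears in the limit; `intCast_pt_eq_zero_iff`);
* the window as affine functions of the ONE number `t = a_∞(1,1)` (classically `t = 1/π` — a transcendental input NOT claimed here):
  `aZ2_two_zero` (`1 − 2t`), `aZ2_two_one` (`2t − 1/4`), `aZ2_three_zero` (`17/4 − 12t`), `aZ2_three_one_add_two_two` (`9t − 2`;
  separating `a(3,1)` from `a(2,2)` needs the diagonal value `a(2,2) = 4/(3π)`, a second transcendental input) — all consistent with `aInfKT`;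
* ★ `aZ2_eq_aInfKT_of_quadraticLaw`: IF the measured periodisation law `TorusKernelQuadraticLaw L` holds for every `L`, then `aZ2 = aInfKT`
  on the window `0 ≤ y ≤ x ≤ 3` (so the hypothesis matrix `A∞` of the tail certificate is `2·aZ2` there).
Prover seat `hubbard-h0-rotor-p2` g2; helper for stmt-HubbardSuperconductivity-19089 (`--supports`, helper class).
WHAT THIS IS NOT: nothing here proves superconductivity in the Hubbard model; the rotor TARGET as originally worded stays
FALSE (g15 verdict).  Structure of ONE analytic input (periodisation / the ℤ² skeleton) of ONE input (HOLE₂) of ONE conditional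
reduction (rung 19089); the transcendental window values (`1/π`, `4/(3π)`, …) remain inputs.  Mathlib + tree imports only; no sorry, no axioms.
-/

set_option linter.dupNamespace false

noncomputable section

open scoped BigOperators
open Complex Finset

namespace Summit.HubbardSuperconductivity.HubbardSuperconductivity.Theorems.AnisotropyChord.Transfer.Fibre3

namespace Subsample

/-! ## The ℤ² kernel `aZ2`: symmetries, normalisation `a(±1,0) = 1/4`, harmonicity, the window in terms of `a(1,1)` -/

section ZSquare

open Filter Topology

/-- ★ every integer point: `a^{(2^{k+1})}_0(x, y) → a_∞(x, y)` (the chain through `1`, shifted so that every modulus is `≥ 2`). [folklore] -/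
theorem tendsto_aKer_aZ2 (x y : ℤ) :
    Tendsto (fun k : ℕ => aKer (2 ^ (k + 1)) 0 (((x : ℤ) : ZMod (2 ^ (k + 1))), ((y : ℤ) : ZMod (2 ^ (k + 1))))) atTop
      (𝓝 (aZ2 x y)) := by
  have h := aDyad_tendsto 1 x y
  rw [aInf_eq_aZ2] at h
  refine (h.comp (tendsto_add_atTop_nat 1)).congr fun k => ?_
  show aDyad 1 x y (k + 1) = _
  unfold aDyad
  exact aKer_intCast_congr (mul_one (2 ^ (k + 1))) 0 x y

/-- `1/(2^{k+1})² → 0`. [folklore] -/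
theorem tendsto_inv_sq_dyadic : Tendsto (fun k : ℕ => 1 / ((2 ^ (k + 1) : ℕ) : ℝ) ^ 2) atTop (𝓝 0) := by
  have h : Tendsto (fun k : ℕ => (1 / 4 : ℝ) ^ (k + 1)) atTop (𝓝 0) :=
    (tendsto_pow_atTop_nhds_zero_of_lt_one (by norm_num) (by norm_num)).comp (tendsto_add_atTop_nat 1)
  refine h.congr fun k => ?_
  show (1 / 4 : ℝ) ^ (k + 1) = _
  push_cast
  rw [one_div_pow]
  congr 1
  rw [← pow_mul, show (4 : ℝ) = 2 ^ 2 by norm_num, ← pow_mul]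
  ring

/-- the dyadic moduli are `≥ 2`. [folklore] -/
theorem two_le_two_pow_succ (k : ℕ) : 2 ≤ 2 ^ (k + 1) := by
  calc 2 = 2 ^ 1 := (pow_one 2).symm
    _ ≤ 2 ^ (k + 1) := Nat.pow_le_pow_right (by norm_num) (by omega)

/-- `G̃_λ` is invariant under the axis mirror `(r₁, r₂) ↦ (−r₁, r₂)` (reindex `k ↦ (−k₁, k₂)`). [folklore] -/
theorem Gres_mirror (L : ℕ) [NeZero L] (lam : ℝ) (r : Tor L) : Gres L lam (-r.1, r.2) = Gres L lam r := by
  unfold Gres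
  congr 1
  rw [← Equiv.sum_comp ((Equiv.neg (ZMod L)).prodCongr (Equiv.refl (ZMod L)))]
  refine Finset.sum_congr rfl fun k _ => ?_
  simp only [Equiv.prodCongr_apply, Equiv.neg_apply, Equiv.coe_refl, Prod.map, id_eq]
  have hk : ((-k.1, k.2) = (0 : Tor L)) ↔ (k = 0) := by
    constructor
    · intro h; ext <;> simp_all [Prod.ext_iff]
    · intro h; simp [h]
  unfold gres
  rw [TwoHoleBS.epsT_mirror]
  have hp : phase L (-k.1, k.2) (-r.1, r.2) = phase L k r := TwoHoleBS.phase_mirror_mirror L k r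
  simp only [hk, hp]

/-- ★ symmetries of the ℤ² kernel: swap. [folklore] -/
theorem aZ2_swap (x y : ℤ) : aZ2 y x = aZ2 x y := by
  refine tendsto_nhds_unique (tendsto_aKer_aZ2 y x) ((tendsto_aKer_aZ2 x y).congr fun k => ?_)
  unfold aKer
  rw [← Gres_swap (2 ^ (k + 1)) 0 ((((x : ℤ) : ZMod (2 ^ (k + 1))), ((y : ℤ) : ZMod (2 ^ (k + 1)))) : Tor (2 ^ (k + 1)))]

/-- ★ symmetries of the ℤ² kernel: point reflection. [folklore] -/
theorem aZ2_neg (x y : ℤ) : aZ2 (-x) (-y) = aZ2 x y := by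
  refine tendsto_nhds_unique (tendsto_aKer_aZ2 (-x) (-y)) ((tendsto_aKer_aZ2 x y).congr fun k => ?_)
  have e : ((((-x : ℤ) : ZMod (2 ^ (k + 1))), (((-y : ℤ)) : ZMod (2 ^ (k + 1)))) : Tor (2 ^ (k + 1)))
      = -(((x : ℤ) : ZMod (2 ^ (k + 1))), ((y : ℤ) : ZMod (2 ^ (k + 1)))) := by
    push_cast; rfl
  rw [e]
  unfold aKer
  rw [Gres_neg]

/-- ★ symmetries of the ℤ² kernel: axis mirror. [folklore] -/
theorem aZ2_mirror (x y : ℤ) : aZ2 (-x) y = aZ2 x y := by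
  refine tendsto_nhds_unique (tendsto_aKer_aZ2 (-x) y) ((tendsto_aKer_aZ2 x y).congr fun k => ?_)
  have e : ((((-x : ℤ) : ZMod (2 ^ (k + 1))), ((y : ℤ) : ZMod (2 ^ (k + 1)))) : Tor (2 ^ (k + 1)))
      = (-(((x : ℤ) : ZMod (2 ^ (k + 1))), ((y : ℤ) : ZMod (2 ^ (k + 1)))).1,
          (((x : ℤ) : ZMod (2 ^ (k + 1))), ((y : ℤ) : ZMod (2 ^ (k + 1)))).2) := by
    push_cast; rfl
  rw [e]
  unfold aKer
  rw [Gres_mirror]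

/-- the mirror in the second coordinate. [folklore] -/
theorem aZ2_mirror_y (x y : ℤ) : aZ2 x (-y) = aZ2 x y := by
  rw [← aZ2_neg x (-y), neg_neg, aZ2_mirror]

/-- `a_∞(0, 0) = 0`. [folklore] -/
theorem aZ2_zero : aZ2 0 0 = 0 := by
  refine tendsto_nhds_unique (tendsto_aKer_aZ2 0 0) (tendsto_const_nhds.congr fun k => ?_)
  have e : ((((0 : ℤ) : ZMod (2 ^ (k + 1))), (((0 : ℤ)) : ZMod (2 ^ (k + 1)))) : Tor (2 ^ (k + 1))) = 0 := by
    push_cast; rfl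
  rw [e]
  unfold aKer
  exact (sub_self _).symm

/-- ★ **NORMALISATION:** `a_∞(1, 0) = 1/4` EXACTLY (torus axis value `a^{(L)}_0(eₓ) = (1 − 1/V)/4`, `aKer_zero_axis`, in the limit). [folklore] -/
theorem aZ2_one_zero : aZ2 1 0 = 1 / 4 := by
  have h2 : Tendsto (fun k : ℕ => (1 - 1 / ((2 ^ (k + 1) : ℕ) : ℝ) ^ 2) / 4) atTop (𝓝 ((1 - 0) / 4)) :=
    (tendsto_const_nhds.sub tendsto_inv_sq_dyadic).div_const 4
  rw [sub_zero] at h2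
  refine tendsto_nhds_unique ((tendsto_aKer_aZ2 1 0).congr fun k => ?_) h2
  have e : ((((1 : ℤ) : ZMod (2 ^ (k + 1))), (((0 : ℤ)) : ZMod (2 ^ (k + 1)))) : Tor (2 ^ (k + 1))) = ex (2 ^ (k + 1)) := by
    push_cast; rfl
  rw [e]
  exact aKer_zero_axis (2 ^ (k + 1)) (two_le_two_pow_succ k)

/-- `a_∞(0, 1) = 1/4`. [folklore] -/
theorem aZ2_zero_one : aZ2 0 1 = 1 / 4 := by
  rw [aZ2_swap 1 0, aZ2_one_zero]

/-- on a torus of size `L > |x|, |y|` the integer point `(x, y)` is the origin iff `x = y = 0`. [folklore] -/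
theorem intCast_pt_eq_zero_iff (L : ℕ) [NeZero L] {x y : ℤ} (hx : x.natAbs < L) (hy : y.natAbs < L) :
    ((((x : ℤ) : ZMod L), ((y : ℤ) : ZMod L)) : Tor L) = 0 ↔ (x = 0 ∧ y = 0) := by
  rw [Prod.mk_eq_zero, ZMod.intCast_zmod_eq_zero_iff_dvd, ZMod.intCast_zmod_eq_zero_iff_dvd]
  constructor
  · rintro ⟨hxd, hyd⟩
    exact ⟨Int.eq_zero_of_dvd_of_natAbs_lt_natAbs hxd (by simpa using hx),
      Int.eq_zero_of_dvd_of_natAbs_lt_natAbs hyd (by simpa using hy)⟩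
  · rintro ⟨rfl, rfl⟩
    simp

/-- ★★ **HARMONICITY OF THE ℤ² KERNEL:** `a_∞(x+1,y) + a_∞(x−1,y) + a_∞(x,y+1) + a_∞(x,y−1) = 4a_∞(x,y) + δ_{(x,y),0}`
(torus harmonicity `kernelHarmonicity_holds` at `λ = 0`, whose zero-mode term `−1/V` disappears in the limit). [folklore] -/
theorem aZ2_harmonic (x y : ℤ) :
    aZ2 (x + 1) y + aZ2 (x - 1) y + aZ2 x (y + 1) + aZ2 x (y - 1)
      = 4 * aZ2 x y + (if (x = 0 ∧ y = 0) then (1 : ℝ) else 0) := by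
  have hlhs := (((tendsto_aKer_aZ2 (x + 1) y).add (tendsto_aKer_aZ2 (x - 1) y)).add (tendsto_aKer_aZ2 x (y + 1))).add
    (tendsto_aKer_aZ2 x (y - 1))
  have hrhs : Tendsto (fun k : ℕ => 4 * aKer (2 ^ (k + 1)) 0 (((x : ℤ) : ZMod (2 ^ (k + 1))), ((y : ℤ) : ZMod (2 ^ (k + 1))))
      + (if (x = 0 ∧ y = 0) then (1 : ℝ) else 0) - 1 / ((2 ^ (k + 1) : ℕ) : ℝ) ^ 2) atTop
      (𝓝 (4 * aZ2 x y + (if (x = 0 ∧ y = 0) then (1 : ℝ) else 0) - 0)) :=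
    (((tendsto_aKer_aZ2 x y).const_mul 4).add tendsto_const_nhds).sub tendsto_inv_sq_dyadic
  rw [sub_zero] at hrhs
  refine tendsto_nhds_unique (hlhs.congr' ?_) hrhs
  refine Filter.eventually_atTop.mpr ⟨x.natAbs + y.natAbs, fun k hk => ?_⟩
  beta_reduce
  -- on the torus of size `L = 2^(k+1) > |x|, |y|`
  have hkL : k + 1 < 2 ^ (k + 1) := Nat.lt_two_pow_self
  have hxL : x.natAbs < 2 ^ (k + 1) := by omega
  have hyL : y.natAbs < 2 ^ (k + 1) := by omega
  have hL := two_le_two_pow_succ k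
  have h := nbSum_aKer_zero (2 ^ (k + 1)) hL ((((x : ℤ) : ZMod (2 ^ (k + 1))), ((y : ℤ) : ZMod (2 ^ (k + 1)))) : Tor (2 ^ (k + 1)))
  unfold nbSum at h
  have e1 : ((((x : ℤ) : ZMod (2 ^ (k + 1))), ((y : ℤ) : ZMod (2 ^ (k + 1)))) : Tor (2 ^ (k + 1))) + ex (2 ^ (k + 1))
      = ((((x + 1 : ℤ)) : ZMod (2 ^ (k + 1))), ((y : ℤ) : ZMod (2 ^ (k + 1)))) := by
    ext <;> simp [ex]
  have e2 : ((((x : ℤ) : ZMod (2 ^ (k + 1))), ((y : ℤ) : ZMod (2 ^ (k + 1)))) : Tor (2 ^ (k + 1))) + -ex (2 ^ (k + 1))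
      = ((((x - 1 : ℤ)) : ZMod (2 ^ (k + 1))), ((y : ℤ) : ZMod (2 ^ (k + 1)))) := by
    ext <;> simp [ex, sub_eq_add_neg]
  have e3 : ((((x : ℤ) : ZMod (2 ^ (k + 1))), ((y : ℤ) : ZMod (2 ^ (k + 1)))) : Tor (2 ^ (k + 1))) + ey (2 ^ (k + 1))
      = (((x : ℤ) : ZMod (2 ^ (k + 1))), (((y + 1 : ℤ)) : ZMod (2 ^ (k + 1)))) := by
    ext <;> simp [ey]
  have e4 : ((((x : ℤ) : ZMod (2 ^ (k + 1))), ((y : ℤ) : ZMod (2 ^ (k + 1)))) : Tor (2 ^ (k + 1))) + -ey (2 ^ (k + 1))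
      = (((x : ℤ) : ZMod (2 ^ (k + 1))), (((y - 1 : ℤ)) : ZMod (2 ^ (k + 1)))) := by
    ext <;> simp [ey, sub_eq_add_neg]
  rw [e1, e2, e3, e4] at h
  have hiff := intCast_pt_eq_zero_iff (2 ^ (k + 1)) hxL hyL
  by_cases hxy : x = 0 ∧ y = 0
  · rw [if_pos (hiff.mpr hxy)] at h
    rw [if_pos hxy, h]
  · rw [if_neg (fun h0 => hxy (hiff.mp h0))] at h
    rw [if_neg hxy, h]

/-- ★ the window in terms of `t = a_∞(1,1)`: `a_∞(2, 0) = 1 − 2t` (harmonicity at `(1, 0)`; classically `t = 1/π`, NOT claimed). [folklore] -/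
theorem aZ2_two_zero : aZ2 2 0 = 1 - 2 * aZ2 1 1 := by
  have h := aZ2_harmonic 1 0
  norm_num at h
  rw [aZ2_zero, aZ2_one_zero, aZ2_mirror_y] at h
  linarith

/-- `a_∞(2, 1) = 2t − 1/4` (harmonicity at `(1, 1)`). [folklore] -/
theorem aZ2_two_one : aZ2 2 1 = 2 * aZ2 1 1 - 1 / 4 := by
  have h := aZ2_harmonic 1 1
  norm_num at h
  rw [aZ2_zero_one, aZ2_one_zero, aZ2_swap 2 1] at h
  linarith

/-- `a_∞(3, 0) = 17/4 − 12t` (harmonicity at `(2, 0)`). [folklore] -/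
theorem aZ2_three_zero : aZ2 3 0 = 17 / 4 - 12 * aZ2 1 1 := by
  have h := aZ2_harmonic 2 0
  norm_num at h
  rw [aZ2_one_zero, aZ2_mirror_y, aZ2_two_one, aZ2_two_zero] at h
  linarith

/-- `a_∞(3, 1) + a_∞(2, 2) = 9t − 2` (harmonicity at `(2, 1)`; separating the two needs the diagonal value `a_∞(2,2)`,
classically `4/(3π)` — a second transcendental input). [folklore] -/
theorem aZ2_three_one_add_two_two : aZ2 3 1 + aZ2 2 2 = 9 * aZ2 1 1 - 2 := by
  have h := aZ2_harmonic 2 1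
  norm_num at h
  rw [aZ2_two_zero, aZ2_two_one] at h
  linarith

/-- ★ CONSISTENCY WITH THE MEASURED LAW: if the torus periodisation law `TorusKernelQuadraticLaw` (PartN37, measured, `L ≥ 16`)
holds for every modulus, then `a_∞ = aInfKT` on the window `0 ≤ y ≤ x ≤ 3` (in particular `a_∞(1,1) = 1/π`). [folklore] -/
theorem aZ2_eq_aInfKT_of_quadraticLaw (hq : ∀ (L : ℕ) [NeZero L], TorusKernelQuadraticLaw L)
    {x y : ℕ} (hyx : y ≤ x) (hx3 : x ≤ 3) : aZ2 x y = aInfKT x y := by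
  have h1 := tendsto_aKer_aZ2 (x : ℤ) (y : ℤ)
  simp only [Int.cast_natCast] at h1
  set ρ : ℝ := (x : ℝ) ^ 2 + (y : ℝ) ^ 2 with hρ
  have hρ0 : 0 ≤ ρ := by rw [hρ]; positivity
  have hb : ∀ k : ℕ, 3 ≤ k →
      |aKer (2 ^ (k + 1)) 0 (((x : ℕ) : ZMod (2 ^ (k + 1))), ((y : ℕ) : ZMod (2 ^ (k + 1)))) - aInfKT x y|
        ≤ (ρ ^ 2 / 5 + ρ / 4) * (1 / ((2 ^ (k + 1) : ℕ) : ℝ) ^ 2) := by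
    intro k hk
    have hL : 16 ≤ 2 ^ (k + 1) := by
      calc 16 = 2 ^ 4 := by norm_num
        _ ≤ 2 ^ (k + 1) := Nat.pow_le_pow_right (by norm_num) (by omega)
    have h := hq (2 ^ (k + 1)) hL x y hyx hx3
    rw [← hρ] at h
    set V : ℝ := ((2 ^ (k + 1) : ℕ) : ℝ) ^ 2 with hV
    set d : ℝ := aKer (2 ^ (k + 1)) 0 (((x : ℕ) : ZMod (2 ^ (k + 1))), ((y : ℕ) : ZMod (2 ^ (k + 1)))) - aInfKT x y
    have hV1 : 1 ≤ V := by
      rw [hV]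
      have : (1 : ℝ) ≤ ((2 ^ (k + 1) : ℕ) : ℝ) := by exact_mod_cast Nat.one_le_two_pow
      nlinarith
    have hV0 : 0 < V := by linarith
    have h2 : |V * d| ≤ ρ ^ 2 / 5 + ρ / 4 := by
      have h3 : |V * d| ≤ |V * d + ρ / 4| + |ρ / 4| := by
        have := abs_add_le (V * d + ρ / 4) (-(ρ / 4))
        rwa [add_neg_cancel_right, abs_neg] at this
      have h4 : ρ ^ 2 / (5 * V) ≤ ρ ^ 2 / 5 := by
        apply div_le_div_of_nonneg_left (by positivity) (by norm_num)
        linarith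
      rw [abs_of_nonneg (by positivity : (0 : ℝ) ≤ ρ / 4)] at h3
      linarith
    rw [abs_mul, abs_of_pos hV0] at h2
    rw [← div_eq_mul_one_div, le_div_iff₀ hV0, mul_comm]
    exact h2
  have hd : Tendsto (fun k : ℕ =>
      aKer (2 ^ (k + 1)) 0 (((x : ℕ) : ZMod (2 ^ (k + 1))), ((y : ℕ) : ZMod (2 ^ (k + 1)))) - aInfKT x y) atTop (𝓝 0) := by
    refine squeeze_zero_norm' (a := fun k => (ρ ^ 2 / 5 + ρ / 4) * (1 / ((2 ^ (k + 1) : ℕ) : ℝ) ^ 2))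
      (Filter.eventually_atTop.mpr ⟨3, fun k hk => ?_⟩) ?_
    · rw [Real.norm_eq_abs]; exact hb k hk
    · simpa using tendsto_inv_sq_dyadic.const_mul (ρ ^ 2 / 5 + ρ / 4)
  have h3 : Tendsto (fun k : ℕ =>
      aKer (2 ^ (k + 1)) 0 (((x : ℕ) : ZMod (2 ^ (k + 1))), ((y : ℕ) : ZMod (2 ^ (k + 1))))) atTop
      (𝓝 (0 + aInfKT x y)) :=
    (hd.add tendsto_const_nhds).congr fun k => sub_add_cancel _ _
  rw [zero_add] at h3
  exact tendsto_nhds_unique h1 h3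

end ZSquare

end Subsample

end Summit.HubbardSuperconductivity.HubbardSuperconductivity.Theorems.AnisotropyChord.Transfer.Fibre3

end
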